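import Mathlib.Analysis.InnerProductSpace.Calculus
import Mathlib.Analysis.SpecialFunctions.ExpDeriv
import Literature.Analysis.ODE.SchrodingerSturm
import HarnessLib

/-!
# An a priori bound at a regular singular point with conjugate exponents `½ ± iξ`

Topic `Literature/Analysis/ODE` (namespace `Literature.Analysis.ODE`). The scalar linear equation
`W″ = q(x) W` (complex `W`, `q`) on `(0, b]` with a REGULAR SINGULAR POINT at `x = 0` whose
indicial exponents lie on the critical line: `x² q(x) = ν(ν − 1) + g(x)` with `Re ν = ½`
(so the two Frobenius exponents `ν`, `1 − ν = ν̄` are `½ ± iξ`) and `‖g(x)‖ ≤ C x`. The model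
solutions are `x^ν`, `x^{1−ν}`, of modulus `√x`; the classical statement (Olver, *Asymptotics and
Special Functions*, Ch. 5 §§4–5; Coddington–Levinson Ch. 4 Thm 4.1) is that every solution is
`x^ν(c₁ + O(x)) + x^{1−ν}(c₂ + O(x))`. This file proves the QUANTITATIVE half of it that a priori
estimates need, with no series and no special functions, through the energy

  `E(x) = ‖W(x)‖²/x + ‖x W′(x) − ν W(x)‖²/x²`

(for `W = x^ν Y` this is `‖Y‖² + x‖Y′‖²`): along a solution,
`E′ = 2⟪W, P⟫/x² − ‖P‖²/x³ + 2⟪P, g W⟫/x³` with `P = xW′ − νW` (`hasDerivAt_regularSingularEnergy`,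
`regularSingularEnergy_deriv_eq`), hence `E′ ≤ (1 + C)² E` (`regularSingularEnergy_deriv_le`:
`2(1 + C)‖W‖‖P‖/x² − ‖P‖²/x³ ≤ (1 + C)²‖W‖²/x`), so that

* `regularSingularEnergy_le_mul_exp` — `E(x) ≤ E(δ) · exp((1 + C)²(x − δ))` for `0 < δ ≤ x ≤ b`;
* `regularSingularEnergy_le_of_tendsto` — if `E(δ) → L` as `δ → 0⁺` (e.g. `W = x^ν Y` with `Y`
  of class `C¹` up to `x = 0`, `L = ‖Y(0)‖²`), then `E(x) ≤ L · exp((1 + C)² x)` on `(0, b]`;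
  in particular `‖W(x)‖² ≤ x L e^{(1+C)²x}` and `‖xW′(x) − νW(x)‖² ≤ x² L e^{(1+C)²x}`
  (`norm_sq_le_of_regularSingularEnergy_le`).

The point is that the constant depends on `C` and `b` only — not on `Im ν`: this is the
`κ`-free bound for the horizon-normalised solution of the radial Teukolsky equation in the
blown-up radius (exponents `½ ± iξ`, `ξ = (ω − mω₊)/2κ` bounded), where a Grönwall argument in the
tortoise variable would lose `exp(1/κ)`. Hypotheses are pointwise `HasDerivAt` statements; `ℂ` is a
real inner-product space (`⟪z, w⟫ = Re(w z̄)`). Everything is proved; theorems only.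

## References
* F. W. J. Olver, *Asymptotics and Special Functions*, Academic Press 1974, Ch. 5 §4–§5
  (regular singularities, Frobenius exponents). [Olver1974]
* P. Hartman, *Ordinary Differential Equations*, 2nd ed., SIAM 2002, Ch. IV §1, Lemma 1.1
  (a priori bounds by differential inequalities for an energy). [Hartman2002]
-/

noncomputable section

open Set Filter Topology
open scoped ComplexConjugate RealInnerProductSpace

namespace Literature.Analysis.ODE

/-! ### The energy `E = ‖W‖²/x + ‖xW′ − νW‖²/x²` along `W″ = q W` -/

/-- **Derivative of the energy.** If `W′(x) = W₁`-data hold at `x ≠ 0` (`HasDerivAt W (W′ x) x`,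
`HasDerivAt W′ (q x · W x) x`), then `E(y) = ‖W y‖²/y + ‖y W′ y − ν W y‖²/y²` has derivative
`2⟪W, W′⟫/x − ‖W‖²/x² + (2⟪P, W′ + x q W − ν W′⟫ x² − ‖P‖² · 2x)/x⁴` at `x`, `P = xW′ − νW`
(product, chain and quotient rules; `(‖f‖²)′ = 2⟪f, f′⟫`). [folklore] -/
theorem hasDerivAt_regularSingularEnergy {W W' : ℝ → ℂ} {q : ℝ → ℂ} (ν : ℂ) {x : ℝ} (hx : x ≠ 0)
    (hW : HasDerivAt W (W' x) x) (hW' : HasDerivAt W' (q x * W x) x) :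
    HasDerivAt (fun y : ℝ ↦ ‖W y‖ ^ 2 / y + ‖(y : ℂ) * W' y - ν * W y‖ ^ 2 / y ^ 2)
      ((2 * ⟪W x, W' x⟫ * x - ‖W x‖ ^ 2 * 1) / x ^ 2 +
        (2 * ⟪(x : ℂ) * W' x - ν * W x, 1 * W' x + (x : ℂ) * (q x * W x) - ν * W' x⟫ * x ^ 2 -
            ‖(x : ℂ) * W' x - ν * W x‖ ^ 2 * (2 * x)) / (x ^ 2) ^ 2) x := by
  have hP : HasDerivAt (fun y : ℝ ↦ (y : ℂ) * W' y - ν * W y)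
      (1 * W' x + (x : ℂ) * (q x * W x) - ν * W' x) x := by
    have h1 : HasDerivAt (fun y : ℝ ↦ (y : ℂ)) 1 x := by
      simpa using (hasDerivAt_id x).ofReal_comp
    exact (h1.mul hW').sub (hW.const_mul ν)
  have hA : HasDerivAt (fun y : ℝ ↦ ‖W y‖ ^ 2 / y) ((2 * ⟪W x, W' x⟫ * x - ‖W x‖ ^ 2 * 1) / x ^ 2)
      x := hW.norm_sq.div (hasDerivAt_id x) hx
  have hB : HasDerivAt (fun y : ℝ ↦ ‖(y : ℂ) * W' y - ν * W y‖ ^ 2 / y ^ 2)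
      ((2 * ⟪(x : ℂ) * W' x - ν * W x, 1 * W' x + (x : ℂ) * (q x * W x) - ν * W' x⟫ * x ^ 2 -
          ‖(x : ℂ) * W' x - ν * W x‖ ^ 2 * (2 * x)) / (x ^ 2) ^ 2) x := by
    have h2 : HasDerivAt (fun y : ℝ ↦ y ^ 2) (2 * x) x := by simpa using hasDerivAt_pow 2 x
    exact hP.norm_sq.div h2 (pow_ne_zero 2 hx)
  exact hA.add hB

/-- **The derivative of the energy, simplified** (`Re ν = ½`): with `P = xW′ − νW` and
`g = x²q − ν(ν − 1)`, the derivative of `hasDerivAt_regularSingularEnergy` equals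
`2⟪W, P⟫/x² − ‖P‖²/x³ + 2⟪P, g W⟫/x³` (using `xW′ = P + νW`, `⟪W, νW⟫ = ½‖W‖²`,
`x(W′ + xqW − νW′) = (1 − ν)P + gW`, `⟪P, (1 − ν)P⟫ = ½‖P‖²`). [folklore] -/
theorem regularSingularEnergy_deriv_eq (w w₁ qx ν : ℂ) {x : ℝ} (hx : x ≠ 0) (hν : ν.re = 1 / 2) :
    (2 * ⟪w, w₁⟫ * x - ‖w‖ ^ 2 * 1) / x ^ 2 +
        (2 * ⟪(x : ℂ) * w₁ - ν * w, 1 * w₁ + (x : ℂ) * (qx * w) - ν * w₁⟫ * x ^ 2 -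
            ‖(x : ℂ) * w₁ - ν * w‖ ^ 2 * (2 * x)) / (x ^ 2) ^ 2 =
      2 * ⟪w, (x : ℂ) * w₁ - ν * w⟫ / x ^ 2 - ‖(x : ℂ) * w₁ - ν * w‖ ^ 2 / x ^ 3 +
        2 * ⟪(x : ℂ) * w₁ - ν * w, ((x : ℂ) ^ 2 * qx - ν * (ν - 1)) * w⟫ / x ^ 3 := by
  simp only [← Complex.ofReal_pow, Complex.inner, Complex.sq_norm, Complex.normSq_apply,
    Complex.mul_re, Complex.mul_im, Complex.sub_re, Complex.sub_im, Complex.add_re, Complex.add_im,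
    Complex.conj_re, Complex.conj_im, Complex.ofReal_re, Complex.ofReal_im, Complex.one_re,
    Complex.one_im, hν]
  field_simp
  ring

/-- Real arithmetic behind `regularSingularEnergy_deriv_le`: with `I ≤ ab`, `J ≤ b(Cxa)`,
`2I/x² − b²/x³ + 2J/x³ ≤ (1 + C)²(a²/x + b²/x²)` for `x > 0`
(the difference is `(((1 + C)ax − b)² + (1 + C)²b²x + 2(ab − I)x + 2(Cxab − J))/x³`). [folklore] -/
theorem regularSingular_deriv_le_aux {a b I J x C : ℝ} (hx : 0 < x) (hI : I ≤ a * b)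
    (hJ : J ≤ b * (C * x * a)) :
    2 * I / x ^ 2 - b ^ 2 / x ^ 3 + 2 * J / x ^ 3 ≤ (1 + C) ^ 2 * (a ^ 2 / x + b ^ 2 / x ^ 2) := by
  have hx3 : 0 < x ^ 3 := by positivity
  have key : (1 + C) ^ 2 * (a ^ 2 / x + b ^ 2 / x ^ 2) - (2 * I / x ^ 2 - b ^ 2 / x ^ 3 + 2 * J / x ^ 3) =
      ((1 + C) ^ 2 * a ^ 2 * x ^ 2 + (1 + C) ^ 2 * b ^ 2 * x + b ^ 2 - 2 * I * x - 2 * J) / x ^ 3 := by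
    field_simp
    ring
  have hN : 0 ≤ (1 + C) ^ 2 * a ^ 2 * x ^ 2 + (1 + C) ^ 2 * b ^ 2 * x + b ^ 2 - 2 * I * x - 2 * J := by
    nlinarith [sq_nonneg ((1 + C) * a * x - b), mul_le_mul_of_nonneg_right hI hx.le,
      mul_nonneg (sq_nonneg b) hx.le, sq_nonneg (1 + C)]
  have := div_nonneg hN hx3.le
  linarith

/-- **The differential inequality `E′ ≤ (1 + C)² E`.** At `x > 0`, if `Re ν = ½` and
`‖x² q(x) − ν(ν − 1)‖ ≤ C x`, the derivative of the energy is at most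
`(1 + C)² (‖W‖²/x + ‖xW′ − νW‖²/x²)`: by Cauchy–Schwarz
`E′ ≤ 2(1 + C)‖W‖‖P‖/x² − ‖P‖²/x³ ≤ (1 + C)²‖W‖²/x` (complete the square). [folklore] -/
theorem regularSingularEnergy_deriv_le (w w₁ qx ν : ℂ) {x C : ℝ} (hx : 0 < x) (hν : ν.re = 1 / 2) (hg : ‖(x : ℂ) ^ 2 * qx - ν * (ν - 1)‖ ≤ C * x) :
    (2 * ⟪w, w₁⟫ * x - ‖w‖ ^ 2 * 1) / x ^ 2 +
        (2 * ⟪(x : ℂ) * w₁ - ν * w, 1 * w₁ + (x : ℂ) * (qx * w) - ν * w₁⟫ * x ^ 2 -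
            ‖(x : ℂ) * w₁ - ν * w‖ ^ 2 * (2 * x)) / (x ^ 2) ^ 2 ≤
      (1 + C) ^ 2 * (‖w‖ ^ 2 / x + ‖(x : ℂ) * w₁ - ν * w‖ ^ 2 / x ^ 2) := by
  rw [regularSingularEnergy_deriv_eq w w₁ qx ν hx.ne' hν]
  set P : ℂ := (x : ℂ) * w₁ - ν * w with hP
  set g : ℂ := (x : ℂ) ^ 2 * qx - ν * (ν - 1) with hgdef
  have h1 : ⟪w, P⟫ ≤ ‖w‖ * ‖P‖ := real_inner_le_norm w P
  have h2 : ⟪P, g * w⟫ ≤ ‖P‖ * (C * x * ‖w‖) := by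
    calc ⟪P, g * w⟫ ≤ ‖P‖ * ‖g * w‖ := real_inner_le_norm P (g * w)
      _ = ‖P‖ * (‖g‖ * ‖w‖) := by rw [norm_mul]
      _ ≤ ‖P‖ * (C * x * ‖w‖) := by gcongr
  exact regularSingular_deriv_le_aux hx h1 h2

/-! ### Grönwall: the energy grows at most like `exp((1 + C)² x)` -/

/-- **A priori energy bound at a regular singular point, finite form.** Let `W″ = qW` on `(0, b]`
(pointwise `HasDerivAt` data for `W, W′`), `Re ν = ½` and `‖x²q(x) − ν(ν − 1)‖ ≤ Cx`
there. Then for `0 < δ ≤ x ≤ b`: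
`E(x) ≤ E(δ) · exp((1 + C)²(x − δ))`, `E(y) = ‖W y‖²/y + ‖yW′y − νWy‖²/y²`.
[cite: Hartman2002, Ch. IV §1, Lemma 1.1] -/
theorem regularSingularEnergy_le_mul_exp {W W' : ℝ → ℂ} {q : ℝ → ℂ} {ν : ℂ} {C b : ℝ}
    (hν : ν.re = 1 / 2)
    (hW : ∀ x ∈ Ioc 0 b, HasDerivAt W (W' x) x ∧ HasDerivAt W' (q x * W x) x)
    (hq : ∀ x ∈ Ioc 0 b, ‖(x : ℂ) ^ 2 * q x - ν * (ν - 1)‖ ≤ C * x) {δ x : ℝ} (hδ : 0 < δ)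
    (hδx : δ ≤ x) (hxb : x ≤ b) :
    ‖W x‖ ^ 2 / x + ‖(x : ℂ) * W' x - ν * W x‖ ^ 2 / x ^ 2 ≤
      (‖W δ‖ ^ 2 / δ + ‖(δ : ℂ) * W' δ - ν * W δ‖ ^ 2 / δ ^ 2) *
        Real.exp ((1 + C) ^ 2 * (x - δ)) := by
  set E : ℝ → ℝ := fun y ↦ ‖W y‖ ^ 2 / y + ‖(y : ℂ) * W' y - ν * W y‖ ^ 2 / y ^ 2 with hE
  have hsub : ∀ s ∈ Icc δ b, s ∈ Ioc 0 b := fun s hs ↦ ⟨hδ.trans_le hs.1, hs.2⟩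
  have hd : ∀ s ∈ Icc δ b, HasDerivAt E _ s := fun s hs ↦
    hasDerivAt_regularSingularEnergy ν (hδ.trans_le hs.1).ne' (hW s (hsub s hs)).1
      (hW s (hsub s hs)).2
  have h := le_mul_exp_of_deriv_le (v := E) (κ := -(1 + C) ^ 2) (S := δ) (b := b)
    (fun s hs ↦ (hd s hs).differentiableAt.hasDerivAt)
    (fun s hs ↦ by
      rw [(hd s hs).deriv, neg_neg]
      exact regularSingularEnergy_deriv_le (W s) (W' s) (q s) ν (hδ.trans_le hs.1) hν
        (hq s (hsub s hs)))
    x ⟨hδx, hxb⟩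
  simpa only [hE, neg_neg] using h

/-- **A priori energy bound at a regular singular point, limit form.** Under the hypotheses of
`regularSingularEnergy_le_mul_exp`, if moreover `E(δ) → L` as `δ → 0⁺`, then
`E(x) ≤ L · exp((1 + C)² x)` for every `x ∈ (0, b]`. (For `W = x^ν Y` with `Y` of class `C¹` on
`[0, b]`, `E = ‖Y‖² + x‖Y′‖² → ‖Y(0)‖²`.) [cite: Olver1974, Ch. 5 §5] -/
theorem regularSingularEnergy_le_of_tendsto {W W' : ℝ → ℂ} {q : ℝ → ℂ} {ν : ℂ} {C b L : ℝ}
    (hν : ν.re = 1 / 2)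
    (hW : ∀ x ∈ Ioc 0 b, HasDerivAt W (W' x) x ∧ HasDerivAt W' (q x * W x) x)
    (hq : ∀ x ∈ Ioc 0 b, ‖(x : ℂ) ^ 2 * q x - ν * (ν - 1)‖ ≤ C * x)
    (hlim : Tendsto (fun y : ℝ ↦ ‖W y‖ ^ 2 / y + ‖(y : ℂ) * W' y - ν * W y‖ ^ 2 / y ^ 2)
      (𝓝[>] 0) (𝓝 L))
    {x : ℝ} (hx : x ∈ Ioc 0 b) :
    ‖W x‖ ^ 2 / x + ‖(x : ℂ) * W' x - ν * W x‖ ^ 2 / x ^ 2 ≤ L * Real.exp ((1 + C) ^ 2 * x) := by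
  have hlim' : Tendsto (fun y : ℝ ↦ (‖W y‖ ^ 2 / y + ‖(y : ℂ) * W' y - ν * W y‖ ^ 2 / y ^ 2) *
      Real.exp ((1 + C) ^ 2 * x)) (𝓝[>] 0) (𝓝 (L * Real.exp ((1 + C) ^ 2 * x))) :=
    hlim.mul_const _
  refine ge_of_tendsto hlim' ?_
  filter_upwards [Ioo_mem_nhdsGT hx.1] with δ hδ
  have h := regularSingularEnergy_le_mul_exp hν hW hq hδ.1 hδ.2.le hx.2
  refine h.trans (mul_le_mul_of_nonneg_left (Real.exp_le_exp.2 ?_) ?_)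
  · nlinarith [sq_nonneg (1 + C), hδ.1]
  · have hδ0 : 0 < δ := hδ.1
    positivity

/-- **Reading off `W` and `xW′ − νW`** from an energy bound `E(x) ≤ B` at `x > 0`:
`‖W x‖² ≤ x B` and `‖xW′x − νWx‖² ≤ x² B`. [folklore] -/
theorem norm_sq_le_of_regularSingularEnergy_le {w w₁ ν : ℂ} {x B : ℝ} (hx : 0 < x)
    (h : ‖w‖ ^ 2 / x + ‖(x : ℂ) * w₁ - ν * w‖ ^ 2 / x ^ 2 ≤ B) :
    ‖w‖ ^ 2 ≤ x * B ∧ ‖(x : ℂ) * w₁ - ν * w‖ ^ 2 ≤ x ^ 2 * B := by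
  have hx2 : 0 < x ^ 2 := by positivity
  have hA : 0 ≤ ‖w‖ ^ 2 / x := by positivity
  have hB : 0 ≤ ‖(x : ℂ) * w₁ - ν * w‖ ^ 2 / x ^ 2 := by positivity
  constructor
  · have h1 : ‖w‖ ^ 2 / x ≤ B := by linarith
    rwa [div_le_iff₀' hx] at h1
  · have h1 : ‖(x : ℂ) * w₁ - ν * w‖ ^ 2 / x ^ 2 ≤ B := by linarith
    rwa [div_le_iff₀' hx2] at h1

end Literature.Analysis.ODE

end
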